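import Mathlib
import HarnessLib
import Summits.Ventures.LatticeQCDFlow.Exactness.U1LeapfrogHMCErgodic
import Summits.Ventures.LatticeQCDFlow.Exactness.LeapfrogShortTrajectory
import Summits.Ventures.LatticeQCDFlow.Exactness.ApproxDilationPushforward
import Summits.Ventures.LatticeQCDFlow.Exactness.SphereSpreading

/-!
# Multi-step leapfrog HMC on `U(1)` lattice gauge fields: the kernel at every `nstep`, its exactness, the angle lift, and the position law of a short trajectory

HONEST FRAMING: exact (Metropolis-corrected) sampling algorithms for lattice gauge theory;
figures of merit are autocorrelation/cost numbers at stated couplings and volumes; no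
continuum-physics claim.

Venture `LatticeQCDFlow` (cell pub-lqcd), topic `Exactness`, FANOUT row 9 (eng-latcore, the
engine `latflow.core.u1_2d.U1Field2D.hmc_trajectory(β, τ, nstep)` / `hmc.HMC(f, β, 'leapfrog')`
on the `U(1)` rung with `nstep ≥ 2`).  NEW WORK of the cell over Mathlib and the tree
(`U1LeapfrogHMC.lean` / `U1LeapfrogHMCErgodic.lean`: the `nstep = 1` kernel, the momentum law and
box; `LeapfrogShortTrajectory.lean`: the flat `n`-step estimate; `ApproxDilationPushforward.lean`:
the push-forward of Lebesgue measure through a perturbed dilation; `U1ExpChartMinorisation.lean`: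
`2π • Haar_{U(1)} = dθ|_{(−π,π)} ∘ exp⁻¹`; `SphereSpreading.measure_smul_le_smul_of_le`); nothing here is cited as a fact.  Printed counterparts,
named only: Duane–Kennedy–Pendleton–Roweth 1987; Mackenzie 1989.

Part 1 of 2 (part 2 `U1MultiStepLeapfrogHMCErgodic.lean`: Doeblin, uniform ergodicity, the Wilson
instance).  Links `U : ι → U(1)`, momenta `p : ι → ℝ`, the P-first leapfrog word
`W = K(g) D(e_ε) K(g)` of `U1LeapfrogHMC.lean` (`g` = the half-kick increment, drift
`U_l ← e^{iεp_l} U_l`):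

* §1 `u1LeapfrogProposalN ε g n = flip ∘ Wⁿ` (`n` leapfrog steps then the flip; `n = 1` is
  `u1LeapfrogProposal` by `rfl`), measurable for measurable `g`, an involution, Liouville;
  **`u1LeapfrogHMCN ε κ hg S n`** — the engine's configuration kernel at `nstep = n`
  (`refreshUpdate (involMH (flip ∘ Wⁿ) _ (S + T_κ)) (u1MomentumLaw κ)`; `n = 1` is `u1LeapfrogHMC`
  by `rfl`); **`u1LeapfrogHMCN_invariant`** — EXACT for `e^{−S}·Haar^{⊗ι}` at EVERY `n`
  (`hmc_config_exact`).
* §2 THE ANGLE LIFT: `circleLift U Θ = (e^{iΘ_l} U_l)_l` (`1`-Lipschitz from the sup norm,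
  `circleLift U 0 = U`); **`semiconj_circleLift`** — `W ∘ lift_U = lift_U ∘ lfStep (g ∘ circleLift U) ε`:
  the curved word over `U` IS the flat word of `LeapfrogShortTrajectory` for the lifted force
  `G_U = g ∘ circleLift U`, read through the lift; hence (`fst_u1LeapfrogProposalN`) the proposed
  configuration from `(U, p)` is `circleLift U (θ_n(p))`, `θ_n` the flat `n`-step position from
  `θ₀ = 0`, and (`norm_snd_u1LeapfrogProposalN_le`) the proposed momentum has sup norm
  `≤ ‖p‖ + 2(n+1)b`;
  `u1LeapfrogN_energy_window` — on the box `|p_l| ≤ R`: `H(Ψ(U,p)) ≤ H(U,p) + 2s + κ|ι|(R + 2(n+1)b)²`.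
* §3 THE POSITION LAW OF A SHORT TRAJECTORY: `smul_pi_haar_le_map_circleLift` —
  `(2π)^{|ι|} • Haar^{⊗ι} ≤ (dΘ|_{ball 0 π}) ∘ (circleLift U)⁻¹`;
  **`smul_pi_haar_le_map_fst_u1LeapfrogProposalN`** — if `g` is `K`-Lipschitz with
  `4 K ε n² ≤ 3` (`n ≥ 1`, `ε > 0`) and bounded by `b`, then with `R_n = 3(π + εbn²)/(2nε)`, from EVERY
  configuration `U`, the proposed configuration for box-uniform momenta `p ∼ dp|_{box R_n}` dominates
  `((3/(4nε))·2π)^{|ι|} •` product Haar measure — uniformly in `U`.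

NOT CLAIMED: anything when `4·Lip(g)·ε·nstep² > 3` (Mackenzie 1989), OMF words, `tau_jitter`,
`SU(N)` / spheres (no flat lift), any useful rate, floating point.
-/

noncomputable section

namespace Summit.Ventures.LatticeQCDFlow.Exactness

open MeasureTheory ProbabilityTheory ProbabilityTheory.Kernel Set Metric Function
open Literature.MathematicalPhysics.QuantumFieldTheory (haarProbability)
open scoped ENNReal NNReal

variable {ι : Type*}

/-! ## §1 The `n`-step kernel and its exactness -/

section Defs

variable [Fintype ι] (ε : ℝ) (g : (ι → Circle) → ι → ℝ) (n : ℕ)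

/-- **The `n`-step proposal map**: `n` P-first leapfrog steps `(K(g) D(e_ε) K(g))ⁿ` followed by the
momentum flip. -/
def u1LeapfrogProposalN : Equiv.Perm ((ι → Circle) × (ι → ℝ)) :=
  flip * palindromicWord [kick g] (drift (mulDrift (u1ExpDrift ε))) ^ n

omit [Fintype ι] in
/-- At `n = 1` this is the tree's single-step proposal. -/
theorem u1LeapfrogProposalN_one : u1LeapfrogProposalN ε g 1 = u1LeapfrogProposal ε g := rfl

variable {g}

omit [Fintype ι] in
/-- One leapfrog step is measurable (for measurable `g`). -/
theorem measurable_u1LeapfrogWord (hg : Measurable g) :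
    Measurable (⇑(palindromicWord [kick g] (drift (mulDrift (u1ExpDrift (ι := ι) ε))))) := by
  rw [palindromicWord_kick_drift, Equiv.Perm.coe_mul, Equiv.Perm.coe_mul]
  exact (measurable_kick hg).comp
    ((measurable_drift (measurable_mulDrift (measurable_u1ExpDrift ε))).comp (measurable_kick hg))

omit [Fintype ι] in
/-- The `n`-step proposal map is measurable (for measurable `g`). -/
theorem measurable_u1LeapfrogProposalN (hg : Measurable g) :
    Measurable (⇑(u1LeapfrogProposalN ε g n)) := by
  rw [u1LeapfrogProposalN, Equiv.Perm.coe_mul, Equiv.Perm.coe_pow]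
  exact measurable_flip.comp ((measurable_u1LeapfrogWord ε hg).iterate n)

omit [Fintype ι] in
/-- The `n`-step proposal map is an involution (time reversal of the palindromic word). -/
theorem involutive_u1LeapfrogProposalN : Function.Involutive (⇑(u1LeapfrogProposalN ε g n)) :=
  (palindromicWord_pow_isFlipReversible flip_mul_flip
    (drift_isFlipReversible (mulDrift_reversal (u1ExpDrift_neg ε)))
    (fun A hA => by rw [List.mem_singleton] at hA; subst hA; exact kick_isFlipReversible g) n).involutive

/-- The `n`-step proposal map preserves `Haar^{⊗ι} ⊗ Lebesgue` (Liouville). -/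
theorem measurePreserving_u1LeapfrogProposalN (hg : Measurable g) :
    MeasurePreserving (⇑(u1LeapfrogProposalN ε g n))
      ((Measure.pi fun _ : ι => haarProbability (Circle)).prod volume)
      ((Measure.pi fun _ : ι => haarProbability (Circle)).prod volume) := by
  haveI := isNegInvariant_volume_pi (Λ := ι)
  rw [u1LeapfrogProposalN, Equiv.Perm.coe_mul]
  exact measurePreserving_flip.comp (measurePreserving_perm_pow
    (measurePreserving_palindromicWord
      (measurePreserving_drift (measurable_mulDrift (measurable_u1ExpDrift ε))
        (measurePreserving_mulDrift (u1ExpDrift ε)))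
      (fun A hA => by rw [List.mem_singleton] at hA; subst hA; exact measurePreserving_kick hg)) n)

variable (κ : ℝ)

/-- **THE ENGINE'S CONFIGURATION KERNEL AT `nstep = n`** (`hmc_trajectory(β, τ = nε, nstep = n)`):
refresh `p ∼ Z⁻¹e^{−T_κ}`, `n` P-first leapfrog steps of size `ε`, flip, Metropolis test on
`S + T_κ`, forget `p`. -/
def u1LeapfrogHMCN (hg : Measurable g) (S : (ι → Circle) → ℝ) (n : ℕ) :
    Kernel (ι → Circle) (ι → Circle) :=
  refreshUpdate
    (involMH (⇑(u1LeapfrogProposalN ε g n)) (measurable_u1LeapfrogProposalN ε n hg)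
      fun z => S z.1 + u1Kinetic κ z.2)
    (u1MomentumLaw κ)

/-- At `n = 1` this is the tree's single-step kernel `u1LeapfrogHMC`. -/
theorem u1LeapfrogHMCN_one (hg : Measurable g) (S : (ι → Circle) → ℝ) :
    u1LeapfrogHMCN ε κ hg S 1 = u1LeapfrogHMC ε κ hg S := rfl

variable {ε κ n}

/-- **Exactness at every `nstep`**: the kernel leaves `e^{−S} · Haar^{⊗ι}` invariant for every
measurable `S`, every `ε`, every `κ > 0`, every measurable `g`, every `n`. -/
theorem u1LeapfrogHMCN_invariant (hκ : 0 < κ) (hg : Measurable g)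
    {S : (ι → Circle) → ℝ} (hS : Measurable S) (n : ℕ) :
    Invariant (u1LeapfrogHMCN ε κ hg S n)
      ((Measure.pi fun _ : ι => haarProbability (Circle)).withDensity
        fun u => ENNReal.ofReal (Real.exp (-S u))) :=
  hmc_config_exact (vol := Measure.pi fun _ : ι => haarProbability (Circle))
    (volP := volume) (hΦ := measurable_u1LeapfrogProposalN ε n hg) hS (measurable_u1Kinetic κ)
    (involutive_u1LeapfrogProposalN ε n) (measurePreserving_u1LeapfrogProposalN ε n hg)
    (u1MomentumWeight_univ_ne_zero hκ) (u1MomentumWeight_univ_ne_top hκ)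

/-- The kernel leaves the normalised Gibbs law `u1GibbsLaw S` invariant. -/
theorem u1LeapfrogHMCN_invariant_gibbsLaw (hκ : 0 < κ) (hg : Measurable g)
    {S : (ι → Circle) → ℝ} (hS : Measurable S) (n : ℕ) :
    Invariant (u1LeapfrogHMCN ε κ hg S n) (u1GibbsLaw S) :=
  invariant_smul (u1LeapfrogHMCN_invariant hκ hg hS n) _

end Defs

/-! ## §2 The angle lift: the curved word is the flat word read through `Θ ↦ e^{iΘ}·U` -/

section Lift

variable (u : ι → Circle)

/-- **The angle lift at a base configuration** `U`: `circleLift U Θ = (e^{iΘ_l} U_l)_l`. -/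
def circleLift (Θ : ι → ℝ) : ι → Circle := fun l => Circle.exp (Θ l) * u l

/-- Pointwise formula. -/
@[simp] theorem circleLift_apply (Θ : ι → ℝ) (l : ι) : circleLift u Θ l = Circle.exp (Θ l) * u l := rfl
/-- `circleLift U 0 = U`. -/
@[simp] theorem circleLift_zero : circleLift u 0 = u := by funext l; simp [circleLift]

/-- The lift is continuous. -/
theorem continuous_circleLift : Continuous (circleLift u) :=
  continuous_pi fun l => (Circle.exp.continuous.comp (continuous_apply l)).mul continuous_const

/-- One link: `|e^{iθ} v − e^{iθ'} v| ≤ |θ − θ'|`. -/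
theorem dist_exp_mul_le (θ θ' : ℝ) (v : Circle) :
    dist (Circle.exp θ * v) (Circle.exp θ' * v) ≤ dist θ θ' := by
  have hd : dist (Circle.exp θ * v) (Circle.exp θ' * v) =
      dist ((Circle.exp θ * v : Circle) : ℂ) ((Circle.exp θ' * v : Circle) : ℂ) := rfl
  rw [hd, dist_eq_norm, Circle.coe_mul, Circle.coe_mul, ← sub_mul, norm_mul,
    Circle.norm_coe, mul_one, Circle.coe_exp, Circle.coe_exp, Real.dist_eq]
  have h : Complex.exp (θ * Complex.I) - Complex.exp (θ' * Complex.I) =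
      Complex.exp (θ' * Complex.I) * (Complex.exp (Complex.I * ↑(θ - θ')) - 1) := by
    rw [mul_sub, mul_one, ← Complex.exp_add]
    congr 2
    push_cast
    ring
  rw [h, norm_mul, Complex.norm_exp_ofReal_mul_I, one_mul]
  exact Real.norm_exp_I_mul_ofReal_sub_one_le.trans (by rw [Real.norm_eq_abs])

variable [Fintype ι]

/-- The lift is measurable. -/
theorem measurable_circleLift : Measurable (circleLift u) := (continuous_circleLift u).measurable

/-- **The lift is `1`-Lipschitz** from the sup norm on `ι → ℝ` to the sup distance on `U(1)^ι`. -/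
theorem lipschitzWith_circleLift : LipschitzWith 1 (circleLift u) := by
  refine LipschitzWith.of_dist_le_mul fun Θ Θ' => ?_
  rw [NNReal.coe_one, one_mul]
  refine (dist_pi_le_iff dist_nonneg).2 fun l => ?_
  exact (dist_exp_mul_le (Θ l) (Θ' l) (u l)).trans (dist_le_pi_dist Θ Θ' l)

variable (ε : ℝ) (g : (ι → Circle) → ι → ℝ)

omit [Fintype ι] in
/-- **One drift over the lift is the lift of a flat drift**:
`e^{iεm}·(circleLift U Θ) = circleLift U (Θ + ε•m)`. -/
theorem mulDrift_circleLift (Θ m : ι → ℝ) :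
    mulDrift (u1ExpDrift ε) m (circleLift u Θ) = circleLift u (Θ + ε • m) := by
  funext l
  simp only [mulDrift, Equiv.coe_mulLeft, Pi.mul_apply, u1ExpDrift_apply, circleLift_apply,
    Pi.add_apply, Pi.smul_apply, smul_eq_mul]
  rw [Circle.exp_add, ← mul_assoc, mul_comm (Circle.exp (ε * m l))]

/-- **THE INTERTWINING**: one curved leapfrog step over the lift is the lift of one flat leapfrog step
for the lifted force `G_U = g ∘ circleLift U`:
`W (circleLift U Θ, p) = (circleLift U Θ', p')` with `(Θ', p') = lfStep (g ∘ circleLift U) ε (Θ, p)`. -/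
theorem semiconj_circleLift :
    Semiconj (fun z : (ι → ℝ) × (ι → ℝ) => (circleLift u z.1, z.2))
      (lfStep (g ∘ circleLift u) ε)
      ⇑(palindromicWord [kick g] (drift (mulDrift (u1ExpDrift ε)))) := by
  intro z
  rw [palindromicWord_kick_drift, Equiv.Perm.coe_mul, Equiv.Perm.coe_mul]
  simp only [Function.comp_apply, kick, drift, Equiv.coe_fn_mk, lfStep, mulDrift_circleLift]

/-- Iterating: `Wᵏ (U, p)` is the lift of `(lfStep G_U ε)^[k] (0, p)`. -/
theorem u1LeapfrogWord_iterate (p : ι → ℝ) (k : ℕ) :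
    (⇑(palindromicWord [kick g] (drift (mulDrift (u1ExpDrift ε)))))^[k] (u, p) =
      (circleLift u ((lfStep (g ∘ circleLift u) ε)^[k] (0, p)).1,
        ((lfStep (g ∘ circleLift u) ε)^[k] (0, p)).2) := by
  have h := (semiconj_circleLift u ε g).iterate_right k (0, p)
  simp only [circleLift_zero] at h
  exact h.symm

/-- **The proposed configuration is the lift of the flat `n`-step position**:
`(Ψ_n (U, p)).1 = circleLift U (θ_n)`, `θ_n = (lfTraj (g ∘ circleLift U) ε 0 p n).1`. -/
theorem fst_u1LeapfrogProposalN (n : ℕ) (p : ι → ℝ) :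
    (u1LeapfrogProposalN ε g n (u, p)).1 = circleLift u (lfTraj (g ∘ circleLift u) ε 0 p n).1 := by
  rw [u1LeapfrogProposalN, Equiv.Perm.coe_mul, Function.comp_apply, flip_apply, Equiv.Perm.coe_pow,
    u1LeapfrogWord_iterate, lfStep_iterate_fst]

/-- The proposed momentum is minus the flat final momentum. -/
theorem snd_u1LeapfrogProposalN (n : ℕ) (p : ι → ℝ) :
    (u1LeapfrogProposalN ε g n (u, p)).2 = -((lfStep (g ∘ circleLift u) ε)^[n] (0, p)).2 := by
  rw [u1LeapfrogProposalN, Equiv.Perm.coe_mul, Function.comp_apply, flip_apply, Equiv.Perm.coe_pow,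
    u1LeapfrogWord_iterate]

variable {g} {b : ℝ}

/-- A per-link bound on the increment is a sup-norm bound on the lifted force. -/
theorem norm_comp_circleLift_le (hb0 : 0 ≤ b) (hb : ∀ v l, ‖g v l‖ ≤ b) (Θ : ι → ℝ) :
    ‖(g ∘ circleLift u) Θ‖ ≤ b :=
  (pi_norm_le_iff_of_nonneg hb0).2 fun l => hb _ l

/-- **The proposed momentum stays in a box**: `‖(Ψ_n (U, p)).2‖ ≤ ‖p‖ + 2(n+1) b`. -/
theorem norm_snd_u1LeapfrogProposalN_le (hb0 : 0 ≤ b) (hb : ∀ v l, ‖g v l‖ ≤ b) (n : ℕ)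
    (p : ι → ℝ) : ‖(u1LeapfrogProposalN ε g n (u, p)).2‖ ≤ ‖p‖ + 2 * ((n : ℝ) + 1) * b := by
  rw [snd_u1LeapfrogProposalN, norm_neg]
  exact norm_lfStep_iterate_snd_le (norm_comp_circleLift_le u hb0 hb) n

variable {ε} {κ : ℝ}

/-- **The energy window of `n` leapfrog steps**: momenta in the box `|p_l| ≤ R` (`R ≥ 0`),
increment bounded by `b ≥ 0`, action bounded by `s`:
`H(Ψ_n(U, p)) ≤ H(U, p) + 2s + κ|ι|(R + 2(n+1)b)²`. -/
theorem u1LeapfrogN_energy_window (hκ : 0 ≤ κ) (hb0 : 0 ≤ b) (hb : ∀ v l, ‖g v l‖ ≤ b)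
    {S : (ι → Circle) → ℝ} {s : ℝ} (hs : ∀ v, |S v| ≤ s) {R : ℝ} (hR0 : 0 ≤ R) (n : ℕ)
    {p : ι → ℝ} (hp : ∀ l, ‖p l‖ ≤ R) :
    (fun z : (ι → Circle) × (ι → ℝ) => S z.1 + u1Kinetic κ z.2) (u1LeapfrogProposalN ε g n (u, p)) ≤
      (fun z : (ι → Circle) × (ι → ℝ) => S z.1 + u1Kinetic κ z.2) (u, p) +
        (2 * s + κ * (Fintype.card ι * (R + 2 * ((n : ℝ) + 1) * b) ^ 2)) := by
  have hpR : ‖p‖ ≤ R := (pi_norm_le_iff_of_nonneg hR0).2 hp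
  have hmom : ∀ l, ‖(u1LeapfrogProposalN ε g n (u, p)).2 l‖ ≤ R + 2 * ((n : ℝ) + 1) * b := fun l =>
    (norm_le_pi_norm _ l).trans ((norm_snd_u1LeapfrogProposalN_le u ε hb0 hb n p).trans (by linarith))
  have h1 : S (u1LeapfrogProposalN ε g n (u, p)).1 ≤ s := (abs_le.1 (hs _)).2
  have h2 : -s ≤ S u := (abs_le.1 (hs u)).1
  have h3 : 0 ≤ u1Kinetic κ p := u1Kinetic_nonneg hκ p
  have h4 : u1Kinetic κ (u1LeapfrogProposalN ε g n (u, p)).2 ≤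
      κ * (Fintype.card ι * (R + 2 * ((n : ℝ) + 1) * b) ^ 2) :=
    u1Kinetic_le_of_norm_le hκ hmom
  dsimp only
  linarith

end Lift

/-! ## §3 The position law of a short trajectory dominates product Haar measure -/

section PositionLaw

variable [Fintype ι] {ε : ℝ} {g : (ι → Circle) → ι → ℝ} {b : ℝ}

/-- The momentum box of `U1LeapfrogHMCErgodic` is the sup-norm ball (`R > 0`). -/
theorem u1MomBox_eq_ball {R : ℝ} (hR : 0 < R) : u1MomBox (ι := ι) R = ball (0 : ι → ℝ) R := by
  rw [u1MomBox, ball_pi _ hR]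
  rfl

/-- One link: `2π • Haar ≤ (dθ|_{|θ|<π}) ∘ (θ ↦ e^{iθ}·v)⁻¹` (an equality; the frozen factor `v` is
absorbed by right invariance). -/
theorem smul_haar_le_map_exp_mul (v : Circle) :
    ENNReal.ofReal (2 * Real.pi) • haarProbability Circle ≤
      (volume.restrict (ball (0 : ℝ) Real.pi)).map (fun θ : ℝ => Circle.exp θ * v) := by
  have hcomp : (fun θ : ℝ => Circle.exp θ * v) = (fun w : Circle => w * v) ∘ Circle.exp := rfl
  have hm2 : Measurable fun w : Circle => w * v := measurable_mul_const v
  rw [hcomp, ← Measure.map_map hm2 Circle.exp.continuous.measurable,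
    ← smul_haarProbability_circle_eq_map_exp, Measure.map_smul, map_mul_right_eq_self]

/-- **`(2π)^{|ι|} •` product Haar `≤ (dΘ|_{ball 0 π}) ∘ (circleLift U)⁻¹`** for every `U`
(link by link, `LeapfrogHMCDoeblin.smul_pi_le_pi`). -/
theorem smul_pi_haar_le_map_circleLift (u : ι → Circle) :
    (ENNReal.ofReal (2 * Real.pi) ^ Fintype.card ι) • Measure.pi (fun _ : ι => haarProbability Circle) ≤
      (volume.restrict (ball (0 : ι → ℝ) Real.pi)).map (circleLift u) := by
  classical
  haveI hfin : IsFiniteMeasure ((volume : Measure ℝ).restrict (ball (0 : ℝ) Real.pi)) :=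
    ⟨by rw [Measure.restrict_apply_univ]; exact measure_ball_lt_top⟩
  have hF : circleLift u = fun Θ l => (fun (l : ι) (θ : ℝ) => Circle.exp θ * u l) l (Θ l) := rfl
  have hball : ball (0 : ι → ℝ) Real.pi = Set.pi univ fun _ => ball (0 : ℝ) Real.pi := by
    rw [ball_pi _ Real.pi_pos]
    rfl
  rw [hF, hball, volume_pi, Measure.restrict_pi_pi,
    Measure.pi_map_pi (fun l => (show Measurable (fun θ : ℝ => Circle.exp θ * u l) from
      Circle.exp.continuous.measurable.mul_const (u l)).aemeasurable),
    ← Finset.card_univ, ← Finset.prod_const]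
  exact smul_pi_le_pi fun l => smul_haar_le_map_exp_mul (u l)

/-- The box radius of the argument: `R_n = 3(π + εbn²)/(2nε)`. -/
def shortTrajRadius (ε b : ℝ) (n : ℕ) : ℝ := 3 * (Real.pi + ε * b * (n : ℝ) ^ 2) / (2 * ((n : ℝ) * ε))

/-- `R_n > 0` (`ε > 0`, `n ≥ 1`, `b ≥ 0`). -/
theorem shortTrajRadius_pos (hε : 0 < ε) (hb0 : 0 ≤ b) {n : ℕ} (hn : 1 ≤ n) :
    0 < shortTrajRadius ε b n := by
  have hn' : (1 : ℝ) ≤ n := by exact_mod_cast hn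
  unfold shortTrajRadius
  have : 0 < Real.pi + ε * b * (n : ℝ) ^ 2 := by positivity
  positivity

/-- **THE POSITION LAW OF A SHORT TRAJECTORY DOMINATES PRODUCT HAAR MEASURE, UNIFORMLY IN THE START.**
`ε > 0`, `n ≥ 1`, `g` `K`-Lipschitz with `4 K ε n² ≤ 3` and bounded by `b ≥ 0`: from EVERY
configuration `U`, the proposed configuration of the `n`-step leapfrog for box-uniform momenta
`p ∼ dp|_{box R_n}` dominates `((3/(4nε))·2π)^{|ι|} •` product Haar measure. -/
theorem smul_pi_haar_le_map_fst_u1LeapfrogProposalN (hε : 0 < ε) {n : ℕ} (hn : 1 ≤ n) {K : ℝ≥0}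
    (hgK : LipschitzWith K g) (hshort : 4 * (K : ℝ) * ε * (n : ℝ) ^ 2 ≤ 3) (hb0 : 0 ≤ b)
    (hb : ∀ v l, ‖g v l‖ ≤ b) (u : ι → Circle) :
    (ENNReal.ofReal ((4 * ((n : ℝ) * ε) / 3)⁻¹ ^ Fintype.card ι) *
        ENNReal.ofReal (2 * Real.pi) ^ Fintype.card ι) •
        Measure.pi (fun _ : ι => haarProbability Circle) ≤
      (volume.restrict (u1MomBox (ι := ι) (shortTrajRadius ε b n))).map
        (fun p => (u1LeapfrogProposalN ε g n (u, p)).1) := by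
  have hn' : (1 : ℝ) ≤ n := by exact_mod_cast hn
  set τ : ℝ := (n : ℝ) * ε with hτ
  have hτ0 : 0 < τ := by positivity
  set Φ : (ι → ℝ) → (ι → ℝ) := fun p => (lfTraj (g ∘ circleLift u) ε 0 p n).1 with hΦ
  have hG : LipschitzWith K (g ∘ circleLift u) := by
    simpa using hgK.comp (lipschitzWith_circleLift u)
  have hA : ∀ p p', ‖Φ p - Φ p' - τ • (p - p')‖ ≤ τ / 3 * ‖p - p'‖ := fun p p' =>
    lfTraj_pos_approx hG hε.le hshort p p'
  have hD : ‖Φ 0‖ ≤ ε * b * (n : ℝ) ^ 2 := by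
    have h := lfTraj_fst_sub_le (θ₀ := (0 : ι → ℝ)) (p := (0 : ι → ℝ))
      (norm_comp_circleLift_le u hb0 hb) hε.le n
    simpa using h
  have hcτ : τ / 3 < τ := by linarith
  have hc : 0 ≤ τ / 3 := by positivity
  have hR : Real.pi + ε * b * (n : ℝ) ^ 2 ≤ (τ - τ / 3) * shortTrajRadius ε b n := by
    unfold shortTrajRadius
    rw [← hτ]
    apply le_of_eq
    field_simp
    ring
  have hpush := smul_restrict_ball_zero_le_map_of_approx hcτ hc hA hD hR
  have h43 : τ + τ / 3 = 4 * τ / 3 := by ring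
  rw [h43] at hpush
  have hΦm : Measurable Φ := (continuous_of_approx hτ0.le hc hA).measurable
  have hfun : (fun p => (u1LeapfrogProposalN ε g n (u, p)).1) = circleLift u ∘ Φ :=
    funext (fst_u1LeapfrogProposalN u ε g n)
  rw [hfun, ← Measure.map_map (measurable_circleLift u) hΦm,
    u1MomBox_eq_ball (shortTrajRadius_pos hε hb0 hn)]
  calc (ENNReal.ofReal ((4 * τ / 3)⁻¹ ^ Fintype.card ι) * ENNReal.ofReal (2 * Real.pi) ^ Fintype.card ι) •
        Measure.pi (fun _ : ι => haarProbability Circle)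
      = ENNReal.ofReal ((4 * τ / 3)⁻¹ ^ Fintype.card ι) •
          ((ENNReal.ofReal (2 * Real.pi) ^ Fintype.card ι) • Measure.pi (fun _ : ι => haarProbability Circle)) := by
        rw [smul_smul]
    _ ≤ ENNReal.ofReal ((4 * τ / 3)⁻¹ ^ Fintype.card ι) •
          (volume.restrict (ball (0 : ι → ℝ) Real.pi)).map (circleLift u) :=
        measure_smul_le_smul_of_le (smul_pi_haar_le_map_circleLift u) _
    _ = (ENNReal.ofReal ((4 * τ / 3)⁻¹ ^ Fintype.card ι) •
          volume.restrict (ball (0 : ι → ℝ) Real.pi)).map (circleLift u) := by rw [Measure.map_smul]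
    _ ≤ ((volume.restrict (ball (0 : ι → ℝ) (shortTrajRadius ε b n))).map Φ).map (circleLift u) :=
        Measure.map_mono hpush (measurable_circleLift u)

end PositionLaw

end Summit.Ventures.LatticeQCDFlow.Exactness
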